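import Summits.ValiantsHypothesis.ValiantsHypothesis.Theorems.BinomialElusivePeelingLemmaFewSlots

/-!
# Shapes with few private slots near a branch vertex (all-X designs against `BinomialElusive.PeelingLemma`)

Helper for the crux stmt-ValiantsHypothesis-7391 (negative lane; `Cruxes/PeelingLemma/DETERMINISTIC-ALLX.md`
§3d, the branch case (β) of the local lemma).  Near the branch vertex `b` (position `P`) of a gadget the
letters born at positions `≤ P` are shared by the five arms, while the letters born at positions `> P` are
private to their arm; so only the coefficients at positions `> P` are guaranteed slots.  This file
classifies the charge configurations of one arm and one side, supported in `[P+1, P+k₁]` with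
`k₁ ≤ 2q`, whose ONLY private slot is the top one: they are a single charge at `P+1` (type X, `k₁ = 1`) or
an equal pair at `P+k₁-1, P+k₁` (type Y) — `shape_of_no_lower_slots`.  (Blueprint §3d: types X/Y/Z/R.)
Pure window calculus (`coef_add_coef_succ`, `charge_sum_apply_top`); no Theses import.
-/

namespace Summit.ValiantsHypothesis.ValiantsHypothesis.Theorems.PeelingLemmaWindow

-- summit = sub-problem name (single-conjunct summit, D-0017 layout), so the namespace repeats it
set_option linter.dupNamespace false

open scoped BigOperators
open Finset

variable {Λ : Type*} [DecidableEq Λ]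

/-- **Few private slots force type X or Y.**  Let the charges `c` of one arm and one side above the
branch position `P` be supported in `[P+1, P+k₁]` with `1 ≤ k₁ ≤ 2q` and `c (P+k₁) ≠ 0`.  If no private
letter below the top is a slot — the coefficients at the positions `P+1, …, P+k₁-1` all vanish — then
either `k₁ = 1` (a single charge at `P+1`) or the configuration ends with an equal pair
`c (P+k₁-1) = c (P+k₁)` and all charges below it vanish. -/
theorem shape_of_no_lower_slots {f : ℤ → Λ} (hf : Function.Injective f) (q : ℕ) (c : ℤ → ℤ)
    (P : ℤ) (k₁ : ℕ) (hk₁ : 1 ≤ k₁) (hk₁q : k₁ ≤ 2 * q)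
    (hzero : ∀ k : ℕ, 1 ≤ k → k < k₁ →
      ∑ t ∈ Finset.Icc (P + 1) (P + k₁), c t * win f q t (f (P + k)) = 0) :
    k₁ = 1 ∨ (c (P + k₁ - 1) = c (P + k₁) ∧ ∀ k : ℕ, 1 ≤ k → k + 2 ≤ k₁ → c (P + k) = 0) := by
  set S := Finset.Icc (P + 1) (P + k₁) with hS
  let coef : ℤ → ℤ := fun τ => ∑ t ∈ S, c t * win f q t (f τ)
  have hmemS : ∀ t, t ∈ S ↔ P + 1 ≤ t ∧ t ≤ P + k₁ := fun t => Finset.mem_Icc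
  have hz : ∀ k : ℕ, 1 ≤ k → k < k₁ → coef (P + k) = 0 := fun k hk hkk => hzero k hk hkk
  -- recursion: for 1 ≤ k ≤ k₁ - 1, coef (P+k) + coef (P+k+1) = c (P+k)
  have hrec : ∀ k : ℕ, 1 ≤ k → k < k₁ → coef (P + k) + coef (P + k + 1) = c (P + k) := by
    intro k hk hkk
    have h := coef_add_coef_succ hf q S c (P + k)
    simp only [hmemS] at h
    rw [if_pos ⟨by omega, by omega⟩, if_neg (by omega), add_zero] at h
    exact h
  -- the top coefficient is the top charge
  have htop : coef (P + k₁) = c (P + k₁) :=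
    charge_sum_apply_top hf q S c (Finset.mem_Icc.mpr ⟨by omega, le_rfl⟩)
      (fun t ht hlt => absurd (Finset.mem_Icc.mp ht).2 (not_le.mpr hlt))
  rcases Nat.lt_or_ge k₁ 2 with h1 | h2
  · left; omega
  · right
    constructor
    · have h := hrec (k₁ - 1) (by omega) (by omega)
      rw [hz (k₁ - 1) (by omega) (by omega), zero_add,
        show P + ((k₁ - 1 : ℕ) : ℤ) + 1 = P + (k₁ : ℤ) by omega, htop] at h
      rw [show P + (k₁ : ℤ) - 1 = P + ((k₁ - 1 : ℕ) : ℤ) by omega]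
      exact h.symm
    · intro k hk hk2
      have h := hrec k hk (by omega)
      have h2' := hz (k + 1) (by omega) (by omega)
      rw [show P + ((k + 1 : ℕ) : ℤ) = P + (k : ℤ) + 1 by push_cast; ring] at h2'
      rw [hz k hk (by omega), h2', add_zero] at h
      exact h.symm

end Summit.ValiantsHypothesis.ValiantsHypothesis.Theorems.PeelingLemmaWindow
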